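import Literature.Analysis.FunctionSpaces.TorusSymL2
import Literature.Analysis.FunctionSpaces.TorusFourierSeries
import Literature.Analysis.FunctionSpaces.TorusLerayHelmholtzProofs
import Literature.Analysis.FunctionSpaces.TorusVectorParseval
import Literature.Analysis.FunctionSpaces.TorusSobolevNormFacts
import HarnessLib

/-!
# Synthesis of real vector fields on `T^d` from the symmetric coefficient space `SymL2 d`

Analysis/FunctionSpaces support file, sequel of `TorusSymL2.lean`: the real Hilbert space
`SymL2 d` of conjugation-symmetric square-summable families is the common carrier of the Sobolev
spaces `H^s(T^d; ℝ^d)`; the level is fixed by a **weight** `w : ℤ^d → ℝ` (positive, even), an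
element `f` representing the field with Fourier coefficients `coef w f k = w(k)⁻¹ f k` (so that
`‖f‖² = ∑ w(k)² ‖coef w f k‖²`, `hasSum_sq_mul_norm_coef`). For the energy-method construction of
Euler flows in the periodic cylinder (`Literature.Analysis.FluidPDE.KatoLai1984_periodicCylinderUniformExistence`)
the nonlinear operator acts on honest functions, and this file provides the passage:

* `SymL2.coef w f` and its algebra; `summable_norm_coef` — if `∑ w(k)⁻² < ∞` the coefficients are
  absolutely summable with `∑ ‖coef w f k‖ ≤ C_w ‖f‖` (Cauchy–Schwarz);
* `SymL2.field w f : T^d → ℝ^d`, the **real field** `Re ∑_k e_k(x) coef w f k`: continuous, with the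
  sup bound `‖field w f x‖ ≤ C_w ‖f‖`, real-linear in `f`, and **real** in the strong sense
  `complexify (field w f x) = ∑_k e_k(x) coef w f k` (conjugation symmetry), whence its Fourier
  coefficients are `coef w f` (`mFourierCoeff_field`);
* `SymL2.integral_inner_field` — **Parseval**: `∫ ⟪field w f, field w' g⟫ = ∑_k Re ⟪coef w f k, coef w' g k⟫`;
* `SymL2.ofSmooth w u` — the element representing a smooth real field `u` at weight `w` of
  polynomial growth (`coef w (ofSmooth w u) = û`, `field w (ofSmooth w u) = u`,
  `‖ofSmooth w u‖² = ∑ w(k)² ‖û k‖²`).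

Everything is proved; no named fact and no `sorry` is introduced.

## Mathlib / tree search

Tree: `Torus.hasSum_mFourier_smul`, `Torus.continuous_tsum_mFourier_smul`,
`Torus.mFourierCoeff_tsum_mFourier_smul` (`TorusLerayHelmholtzProofs`);
`Torus.summable_norm_mFourierCoeff_of_isSmooth`, `Torus.hasSum_realPart_mFourier_smul`,
`Torus.norm_mFourierCoeff_le_of_iterate_bound`, `Torus.exists_iterate_bound` (`TorusFourierSeries`);
`Torus.hasSum_re_inner_mFourierCoeff_complexify` (`TorusVectorParseval`); `Torus.IsConjSymm`,
`Torus.isConjSymm_mFourierCoeff`, `EuclideanSpace.realPart/complexify/conjVec` (`TorusTrigPoly`,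
`Complexify`); `SymL2`, `SymL2.mk`, `SymL2.hasSum_norm_sq` (`TorusSymL2`). Mathlib:
`Finset.sum_mul_sq_le_sq_mul_sq`, `summable_of_sum_le`, `Real.tsum_le_of_sum_le`,
`Equiv.tsum_eq` (reindexing by negation), `ContinuousLinearMap.map_tsum`.

## References

* L. Grafakos, *Classical Fourier Analysis*, 3rd ed., Springer 2014, §3.1–3.3 (Fourier series on
  `T^d`, absolutely convergent series, Plancherel). [Grafakos2014]
* T. Kato, C. Y. Lai, J. Funct. Anal. 56 (1984) 15–28, §2 (the Sobolev scale). [KatoLai1984]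
-/

noncomputable section

open Filter Topology TopologicalSpace Finset MeasureTheory UnitAddTorus
open scoped ENNReal NNReal ComplexConjugate InnerProductSpace

namespace Literature.Analysis.FunctionSpaces

namespace Torus

namespace SymL2

universe u

variable {d : Type u} [Fintype d]

/-! ### Weights and physical coefficients -/

/-- A **weight**: a positive even function on the frequency lattice (e.g. `⟨k⟩^s`). [folklore] -/
structure IsWeight (w : (d → ℤ) → ℝ) : Prop where
  /-- positivity -/
  pos : ∀ k, 0 < w k
  /-- evenness -/
  even : ∀ k, w (-k) = w k

variable {w w' : (d → ℤ) → ℝ}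

/-- **The physical Fourier coefficients** of `f ∈ SymL2 d` at weight `w`: `w(k)⁻¹ f k`. [folklore] -/
def coef (w : (d → ℤ) → ℝ) (f : SymL2 d) (k : d → ℤ) : EuclideanSpace ℂ d := ((w k)⁻¹ : ℂ) • f k

/-- Unfolding. [folklore] -/
theorem coef_apply (w : (d → ℤ) → ℝ) (f : SymL2 d) (k : d → ℤ) : coef w f k = ((w k)⁻¹ : ℂ) • f k := rfl

/-- Recovering the stored coefficient: `f k = w(k) • coef w f k`. [folklore] -/
theorem smul_coef (hw : IsWeight w) (f : SymL2 d) (k : d → ℤ) : (w k : ℂ) • coef w f k = f k := by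
  rw [coef, smul_smul, mul_inv_cancel₀ (by exact_mod_cast (hw.pos k).ne'), one_smul]

/-- `‖coef w f k‖ = w(k)⁻¹ ‖f k‖`. [folklore] -/
theorem norm_coef (hw : IsWeight w) (f : SymL2 d) (k : d → ℤ) : ‖coef w f k‖ = (w k)⁻¹ * ‖f k‖ := by
  rw [coef, norm_smul, norm_inv, Complex.norm_real, Real.norm_of_nonneg (hw.pos k).le]

/-- The physical coefficients are conjugation symmetric. [folklore] -/
theorem isConjSymm_coef (hw : IsWeight w) (f : SymL2 d) : IsConjSymm (coef w f) := fun k => by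
  rw [coef, coef, hw.even, f.apply_neg, EuclideanSpace.conjVec_smul, map_inv₀, Complex.conj_ofReal]

/-- Linearity: coefficients of a sum. [folklore] -/
@[simp] theorem coef_add (f g : SymL2 d) (k : d → ℤ) : coef w (f + g) k = coef w f k + coef w g k := by
  simp [coef, smul_add]

/-- Linearity: coefficients of a difference. [folklore] -/
@[simp] theorem coef_sub (f g : SymL2 d) (k : d → ℤ) : coef w (f - g) k = coef w f k - coef w g k := by
  simp [coef, smul_sub]

/-- Linearity: coefficients of a real multiple. [folklore] -/
@[simp] theorem coef_smul (c : ℝ) (f : SymL2 d) (k : d → ℤ) : coef w (c • f) k = (c : ℂ) • coef w f k := by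
  simp only [coef, SymL2.smul_apply]
  rw [smul_comm]

/-- Coefficients of zero. [folklore] -/
@[simp] theorem coef_zero (k : d → ℤ) : coef w (0 : SymL2 d) k = 0 := by simp [coef]

/-- **The norm through physical coefficients**: `‖f‖² = ∑ w(k)² ‖coef w f k‖²`. [folklore] -/
theorem hasSum_sq_mul_norm_coef (hw : IsWeight w) (f : SymL2 d) :
    HasSum (fun k => w k ^ 2 * ‖coef w f k‖ ^ 2) (‖f‖ ^ 2) := by
  refine (hasSum_norm_sq f).congr_fun fun k => ?_
  rw [norm_coef hw, mul_pow, ← mul_assoc, ← mul_pow, mul_inv_cancel₀ (hw.pos k).ne', one_pow, one_mul]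

/-! ### Absolute summability of the coefficients -/

/-- **Cauchy–Schwarz**: if `∑ w(k)⁻² < ∞` then `∑ ‖coef w f k‖ ≤ (∑ w⁻²)^{1/2} ‖f‖`, in
particular the coefficients are absolutely summable. [folklore] -/
theorem summable_norm_coef (hw : IsWeight w) (hW : Summable fun k => (w k)⁻¹ ^ 2) (f : SymL2 d) :
    Summable (fun k => ‖coef w f k‖) ∧
      ∑' k, ‖coef w f k‖ ≤ Real.sqrt (∑' k, (w k)⁻¹ ^ 2) * ‖f‖ := by
  set A : ℝ := Real.sqrt (∑' k, (w k)⁻¹ ^ 2) * ‖f‖ with hA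
  have hbound : ∀ s : Finset (d → ℤ), ∑ k ∈ s, ‖coef w f k‖ ≤ A := by
    intro s
    have hcs := sum_mul_sq_le_sq_mul_sq s (fun k => (w k)⁻¹) (fun k => ‖f k‖)
    have h1 : ∑ k ∈ s, (w k)⁻¹ ^ 2 ≤ ∑' k, (w k)⁻¹ ^ 2 := hW.sum_le_tsum s fun k _ => sq_nonneg _
    have h2 : ∑ k ∈ s, ‖f k‖ ^ 2 ≤ ‖f‖ ^ 2 := (hasSum_norm_sq f).summable.sum_le_tsum s (fun k _ => sq_nonneg _)
      |>.trans_eq (hasSum_norm_sq f).tsum_eq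
    have hsum_eq : ∑ k ∈ s, ‖coef w f k‖ = ∑ k ∈ s, (w k)⁻¹ * ‖f k‖ := sum_congr rfl fun k _ => norm_coef hw f k
    rw [hsum_eq]
    have hnn : 0 ≤ ∑ k ∈ s, (w k)⁻¹ * ‖f k‖ := sum_nonneg fun k _ => mul_nonneg (inv_nonneg.2 (hw.pos k).le) (norm_nonneg _)
    have hsq : (∑ k ∈ s, (w k)⁻¹ * ‖f k‖) ^ 2 ≤ A ^ 2 := by
      rw [hA, mul_pow, Real.sq_sqrt (tsum_nonneg fun k => sq_nonneg _)]
      exact hcs.trans (mul_le_mul h1 h2 (sum_nonneg fun k _ => sq_nonneg _) (tsum_nonneg fun k => sq_nonneg _))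
    exact (pow_le_pow_iff_left₀ hnn (by positivity) two_ne_zero).1 hsq
  exact ⟨summable_of_sum_le (fun k => norm_nonneg _) hbound, Real.tsum_le_of_sum_le (fun k => norm_nonneg _) hbound⟩

/-! ### The synthesized field -/

/-- **The real vector field represented by `f` at weight `w`**: `Re ∑_k e_k(x) coef w f k`.
[cite: Grafakos2014, §3.3.3] -/
def field (w : (d → ℤ) → ℝ) (f : SymL2 d) (x : UnitAddTorus d) : EuclideanSpace ℝ d :=
  EuclideanSpace.realPart (∑' k, mFourier k x • coef w f k)

/-- Unfolding. [folklore] -/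
theorem field_apply (w : (d → ℤ) → ℝ) (f : SymL2 d) (x : UnitAddTorus d) :
    field w f x = EuclideanSpace.realPart (∑' k, mFourier k x • coef w f k) := rfl

variable (hw : IsWeight w) (hW : Summable fun k => (w k)⁻¹ ^ 2)
include hw hW

/-- The complex series converges absolutely and pointwise. [folklore] -/
theorem hasSum_series (f : SymL2 d) (x : UnitAddTorus d) :
    HasSum (fun k => mFourier k x • coef w f k) (∑' k, mFourier k x • coef w f k) :=
  hasSum_mFourier_smul (summable_norm_coef hw hW f).1 x

/-- **The complex series is conjugation symmetric pointwise**: `conj (∑ e_k(x) c_k) = ∑ e_k(x) c_k`.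
[folklore] -/
theorem conjVec_series (f : SymL2 d) (x : UnitAddTorus d) :
    EuclideanSpace.conjVec (∑' k, mFourier k x • coef w f k) = ∑' k, mFourier k x • coef w f k := by
  have hs := (summable_norm_coef hw hW f).1
  have hsum : Summable fun k => mFourier k x • coef w f k := (hasSum_series hw hW f x).summable
  -- `conjVec` is continuous real-linear, pass it inside, then reindex by `k ↦ -k`
  rw [show EuclideanSpace.conjVec (∑' k, mFourier k x • coef w f k) =
      ∑' k, EuclideanSpace.conjVec (mFourier k x • coef w f k) from
    (EuclideanSpace.conjVecL.map_tsum hsum : _)]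
  rw [← (Equiv.neg (d → ℤ)).tsum_eq (fun k => mFourier k x • coef w f k)]
  refine tsum_congr fun k => ?_
  rw [Equiv.neg_apply, EuclideanSpace.conjVec_smul, (isConjSymm_coef hw f) k]
  congr 1
  -- `conj (e_k(x)) = e_{-k}(x)`
  rw [← mFourier_neg]

/-- **Reality**: `complexify (field w f x) = ∑_k e_k(x) coef w f k`. [folklore] -/
theorem complexify_field (f : SymL2 d) (x : UnitAddTorus d) :
    EuclideanSpace.complexify (field w f x) = ∑' k, mFourier k x • coef w f k :=
  EuclideanSpace.complexify_realPart (conjVec_series hw hW f x)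

/-- **The field is continuous.** [folklore] -/
theorem continuous_field (f : SymL2 d) : Continuous (field w f) :=
  EuclideanSpace.realPart.continuous.comp (continuous_tsum_mFourier_smul (summable_norm_coef hw hW f).1)

/-- **Sup bound**: `‖field w f x‖ ≤ (∑ w⁻²)^{1/2} ‖f‖`. [folklore] -/
theorem norm_field_le (f : SymL2 d) (x : UnitAddTorus d) :
    ‖field w f x‖ ≤ Real.sqrt (∑' k, (w k)⁻¹ ^ 2) * ‖f‖ := by
  obtain ⟨hs, hle⟩ := summable_norm_coef hw hW f
  refine (EuclideanSpace.norm_realPart_le _).trans ?_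
  have hs' : Summable fun k => ‖mFourier k x • coef w f k‖ :=
    hs.congr fun k => by rw [norm_smul, norm_mFourier_apply, one_mul]
  refine (norm_tsum_le_tsum_norm hs').trans ?_
  rw [tsum_congr fun k => show ‖mFourier k x • coef w f k‖ = ‖coef w f k‖ by
    rw [norm_smul, norm_mFourier_apply, one_mul]]
  exact hle

/-- The field is uniformly bounded by a constant times `‖f‖` (bounded continuous). [folklore] -/
theorem exists_norm_field_le : ∃ C : ℝ, 0 ≤ C ∧ ∀ (f : SymL2 d) (x : UnitAddTorus d), ‖field w f x‖ ≤ C * ‖f‖ :=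
  ⟨Real.sqrt (∑' k, (w k)⁻¹ ^ 2), Real.sqrt_nonneg _, norm_field_le hw hW⟩

/-- **Linearity**: the field of a sum. [folklore] -/
theorem field_add (f g : SymL2 d) : field w (f + g) = field w f + field w g := by
  funext x
  rw [Pi.add_apply, field_apply, field_apply, field_apply, ← map_add,
    ← (hasSum_series hw hW f x).summable.tsum_add (hasSum_series hw hW g x).summable]
  congr 1
  exact tsum_congr fun k => by rw [coef_add, smul_add]

/-- Linearity: the field of a real multiple. [folklore] -/
theorem field_smul (c : ℝ) (f : SymL2 d) : field w (c • f) = c • field w f := by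
  funext x
  rw [Pi.smul_apply, field_apply, field_apply, ← map_smul, ← (hasSum_series hw hW f x).summable.tsum_const_smul c]
  congr 1
  refine tsum_congr fun k => ?_
  rw [coef_smul, smul_comm (mFourier k x)]
  exact (RCLike.real_smul_eq_coe_smul (K := ℂ) c _).symm

/-- Linearity: the field of a difference. [folklore] -/
theorem field_sub (f g : SymL2 d) : field w (f - g) = field w f - field w g := by
  rw [sub_eq_add_neg, field_add hw hW, show -g = (-1 : ℝ) • g by simp, field_smul hw hW]
  simp [sub_eq_add_neg]

/-- The field of zero. [folklore] -/
theorem field_zero : field w (0 : SymL2 d) = 0 := by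
  have h := field_smul hw hW (0 : ℝ) (0 : SymL2 d)
  rwa [zero_smul, zero_smul] at h

/-- Two points of view on the sup bound: the field depends Lipschitz-continuously on `f`.
[folklore] -/
theorem norm_field_sub_le (f g : SymL2 d) (x : UnitAddTorus d) :
    ‖field w f x - field w g x‖ ≤ Real.sqrt (∑' k, (w k)⁻¹ ^ 2) * ‖f - g‖ := by
  rw [← Pi.sub_apply, ← field_sub hw hW]
  exact norm_field_le hw hW _ _

/-- **The Fourier coefficients of the field are the physical coefficients.** [folklore] -/
theorem mFourierCoeff_field (f : SymL2 d) (k : d → ℤ) :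
    mFourierCoeff (EuclideanSpace.complexify ∘ field w f) k = coef w f k := by
  have h : (EuclideanSpace.complexify ∘ field w f) = fun x => ∑' l, mFourier l x • coef w f l :=
    funext fun x => complexify_field hw hW f x
  rw [h]
  exact mFourierCoeff_tsum_mFourier_smul (summable_norm_coef hw hW f).1 k

/-- The field is square integrable (continuous on a compact space). [folklore] -/
theorem memLp_field (f : SymL2 d) : MemLp (field w f) 2 volume := by
  obtain ⟨C, -, hC⟩ := exists_norm_field_le hw hW
  exact MemLp.of_bound (continuous_field hw hW f).aestronglyMeasurable (C * ‖f‖) (Eventually.of_forall (hC f))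

omit hw hW in
/-- **Parseval for synthesized fields**: `∫ ⟪field w f, field w' g⟫ = ∑_k Re ⟪coef w f k, coef w' g k⟫`.
[cite: Grafakos2014, Prop. 3.2.7] -/
theorem hasSum_integral_inner_field (hw : IsWeight w) (hW : Summable fun k => (w k)⁻¹ ^ 2)
    (hw' : IsWeight w') (hW' : Summable fun k => (w' k)⁻¹ ^ 2) (f g : SymL2 d) :
    HasSum (fun k => RCLike.re ⟪coef w f k, coef w' g k⟫_ℂ) (∫ x, ⟪field w f x, field w' g x⟫_ℝ) := by
  have h := hasSum_re_inner_mFourierCoeff_complexify (memLp_field hw hW f) (memLp_field hw' hW' g)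
  simp only [mFourierCoeff_field hw hW, mFourierCoeff_field hw' hW'] at h
  exact h

omit hw hW in
/-- **The inner product of `SymL2` through fields**: with the same weight on both sides,
`⟪f, g⟫ = ∑_k w(k)² Re ⟪coef w f k, coef w g k⟫`. [folklore] -/
theorem hasSum_inner_coef (hw : IsWeight w) (f g : SymL2 d) :
    HasSum (fun k => w k ^ 2 * RCLike.re ⟪coef w f k, coef w g k⟫_ℂ) ⟪f, g⟫_ℝ := by
  refine (hasSum_inner f g).congr_fun fun k => ?_
  rw [← smul_coef hw f k, ← smul_coef hw g k, inner_smul_left, inner_smul_right, Complex.conj_ofReal,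
    ← mul_assoc, ← Complex.ofReal_mul]
  simp only [RCLike.re_to_complex, Complex.re_ofReal_mul, sq]

end SymL2

/-! ### Smooth real fields as elements of `SymL2` -/

namespace SymL2

universe v

variable {d : Type v} [Fintype d] [DecidableEq d] {w : (d → ℤ) → ℝ}

/-- A weight of **polynomial growth** `w(k) ≤ C (1 + |k|²)^p`. [folklore] -/
def PolyGrowth (w : (d → ℤ) → ℝ) : Prop := ∃ (C : ℝ) (p : ℕ), ∀ k, |w k| ≤ C * (1 + freqNormSq k) ^ p

/-- For a smooth real field and a weight of polynomial growth, `∑ w(k)² ‖û k‖² < ∞`. [folklore] -/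
theorem summable_sq_weight_mul_norm_mFourierCoeff (hpg : PolyGrowth w) {u : UnitAddTorus d → EuclideanSpace ℝ d}
    (hu : IsSmooth u) : Summable fun k => ‖((w k : ℂ) • mFourierCoeff (EuclideanSpace.complexify ∘ u) k)‖ ^ 2 := by
  obtain ⟨C, p, hC⟩ := hpg
  have hC0 : 0 ≤ C := by
    have := hC 0
    simp [freqNormSq_zero] at this
    exact (abs_nonneg _).trans this
  -- rapid decay of order `p + card d`: `‖û k‖ ≤ K / (1+|k|²)^(p + card d)`
  obtain ⟨K, hK0, hK⟩ := exists_iterate_bound hu (p + Fintype.card d)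
  have hdec : ∀ k, ‖mFourierCoeff (EuclideanSpace.complexify ∘ u) k‖ ≤
      K * ((1 + freqNormSq k) ^ (p + Fintype.card d))⁻¹ :=
    fun k => norm_mFourierCoeff_le_of_iterate_bound hu hK k
  have hpow : ∀ (k : d → ℤ) (n : ℕ), 0 < (1 + freqNormSq k) ^ n := fun k n =>
    pow_pos (by linarith [freqNormSq_nonneg k]) n
  have hinvle : ∀ k : d → ℤ, ((1 + freqNormSq k) ^ Fintype.card d)⁻¹ ≤ 1 := fun k =>
    inv_le_one_of_one_le₀ (one_le_pow₀ (by linarith [freqNormSq_nonneg k]))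
  -- `|w k| ‖û k‖ ≤ C K / (1+|k|²)^{card d}`
  have hb : ∀ k, |w k| * ‖mFourierCoeff (EuclideanSpace.complexify ∘ u) k‖ ≤
      C * K * ((1 + freqNormSq k) ^ Fintype.card d)⁻¹ := by
    intro k
    calc |w k| * ‖mFourierCoeff (EuclideanSpace.complexify ∘ u) k‖
        ≤ (C * (1 + freqNormSq k) ^ p) * (K * ((1 + freqNormSq k) ^ (p + Fintype.card d))⁻¹) :=
          mul_le_mul (hC k) (hdec k) (norm_nonneg _) (mul_nonneg hC0 (hpow k p).le)
      _ = C * K * ((1 + freqNormSq k) ^ Fintype.card d)⁻¹ := by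
          have h1 := (hpow k p).ne'
          have h2 := (hpow k (Fintype.card d)).ne'
          rw [pow_add]
          field_simp
  -- compare with the summable `(C K)² ((1+|k|²)^{card d})⁻¹`
  have hs : Summable fun k : d → ℤ => (C * K) ^ 2 * ((1 + freqNormSq k) ^ Fintype.card d)⁻¹ :=
    summable_inv_one_add_freqNormSq_pow_card.mul_left ((C * K) ^ 2)
  refine hs.of_nonneg_of_le (fun k => sq_nonneg _) fun k => ?_
  rw [norm_smul, Complex.norm_real, Real.norm_eq_abs]
  have h0 : 0 ≤ |w k| * ‖mFourierCoeff (EuclideanSpace.complexify ∘ u) k‖ := by positivity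
  have hi0 : 0 ≤ ((1 + freqNormSq k) ^ Fintype.card d)⁻¹ := inv_nonneg.2 (hpow k _).le
  calc (|w k| * ‖mFourierCoeff (EuclideanSpace.complexify ∘ u) k‖) ^ 2
      ≤ (C * K * ((1 + freqNormSq k) ^ Fintype.card d)⁻¹) ^ 2 := pow_le_pow_left₀ h0 (hb k) 2
    _ = (C * K) ^ 2 * ((1 + freqNormSq k) ^ Fintype.card d)⁻¹ * ((1 + freqNormSq k) ^ Fintype.card d)⁻¹ := by ring
    _ ≤ (C * K) ^ 2 * ((1 + freqNormSq k) ^ Fintype.card d)⁻¹ * 1 :=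
        mul_le_mul_of_nonneg_left (hinvle k) (mul_nonneg (sq_nonneg _) hi0)
    _ = (C * K) ^ 2 * ((1 + freqNormSq k) ^ Fintype.card d)⁻¹ := mul_one _

/-- **The element of `SymL2` representing a smooth real field `u` at weight `w`**: stores
`w(k) û(k)`. [folklore] -/
def ofSmooth (w : (d → ℤ) → ℝ) (hw : IsWeight w) (hpg : PolyGrowth w) (u : UnitAddTorus d → EuclideanSpace ℝ d)
    (hu : IsSmooth u) : SymL2 d :=
  mk (fun k => (w k : ℂ) • mFourierCoeff (EuclideanSpace.complexify ∘ u) k)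
    (summable_sq_weight_mul_norm_mFourierCoeff hpg hu)
    (fun k => by
      simp only [hw.even, (isConjSymm_mFourierCoeff hu.integrable) k, EuclideanSpace.conjVec_smul,
        Complex.conj_ofReal])

/-- The physical coefficients of `ofSmooth w u` are the Fourier coefficients of `u`. [folklore] -/
@[simp] theorem coef_ofSmooth (hw : IsWeight w) (hpg : PolyGrowth w) {u : UnitAddTorus d → EuclideanSpace ℝ d}
    (hu : IsSmooth u) (k : d → ℤ) :
    coef w (ofSmooth w hw hpg u hu) k = mFourierCoeff (EuclideanSpace.complexify ∘ u) k := by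
  rw [coef, ofSmooth, mk_apply, smul_smul, inv_mul_cancel₀ (by exact_mod_cast (hw.pos k).ne'), one_smul]

/-- The stored coefficients of `ofSmooth w u`. [folklore] -/
theorem ofSmooth_apply (hw : IsWeight w) (hpg : PolyGrowth w) {u : UnitAddTorus d → EuclideanSpace ℝ d}
    (hu : IsSmooth u) (k : d → ℤ) :
    ofSmooth w hw hpg u hu k = (w k : ℂ) • mFourierCoeff (EuclideanSpace.complexify ∘ u) k := rfl

/-- **The norm of `ofSmooth w u`**: `‖ofSmooth w u‖² = ∑ w(k)² ‖û k‖²`. [folklore] -/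
theorem hasSum_norm_sq_ofSmooth (hw : IsWeight w) (hpg : PolyGrowth w) {u : UnitAddTorus d → EuclideanSpace ℝ d}
    (hu : IsSmooth u) :
    HasSum (fun k => w k ^ 2 * ‖mFourierCoeff (EuclideanSpace.complexify ∘ u) k‖ ^ 2) (‖ofSmooth w hw hpg u hu‖ ^ 2) := by
  have h := hasSum_sq_mul_norm_coef hw (ofSmooth w hw hpg u hu)
  simp only [coef_ofSmooth] at h
  exact h

/-- **The field of `ofSmooth w u` is `u`** (Fourier inversion for smooth real fields). [folklore] -/
theorem field_ofSmooth (hw : IsWeight w) (hpg : PolyGrowth w) {u : UnitAddTorus d → EuclideanSpace ℝ d}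
    (hu : IsSmooth u) : field w (ofSmooth w hw hpg u hu) = u := by
  funext x
  rw [field_apply]
  simp only [coef_ofSmooth]
  have h := hasSum_mFourier_smul_mFourierCoeff hu x
  rw [h.tsum_eq, EuclideanSpace.realPart_complexify]

/-- `ofSmooth` is additive. [folklore] -/
theorem ofSmooth_add (hw : IsWeight w) (hpg : PolyGrowth w) {u v : UnitAddTorus d → EuclideanSpace ℝ d}
    (hu : IsSmooth u) (hv : IsSmooth v) :
    ofSmooth w hw hpg (u + v) (hu.add hv) = ofSmooth w hw hpg u hu + ofSmooth w hw hpg v hv := by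
  ext k
  rw [add_apply, ofSmooth_apply, ofSmooth_apply, ofSmooth_apply, ← smul_add]
  have : EuclideanSpace.complexify ∘ (u + v) = (EuclideanSpace.complexify ∘ u) + (EuclideanSpace.complexify ∘ v) := by
    funext y; simp
  rw [this, mFourierCoeff_add (integrable_complexify_comp hu.integrable) (integrable_complexify_comp hv.integrable)]

/-- `ofSmooth` is real-homogeneous. [folklore] -/
theorem ofSmooth_smul (hw : IsWeight w) (hpg : PolyGrowth w) (c : ℝ) {u : UnitAddTorus d → EuclideanSpace ℝ d}
    (hu : IsSmooth u) :
    ofSmooth w hw hpg (c • u) (hu.const_smul c) = c • ofSmooth w hw hpg u hu := by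
  ext k
  rw [smul_apply, ofSmooth_apply, ofSmooth_apply, smul_comm]
  have : EuclideanSpace.complexify ∘ (c • u) = (c : ℂ) • (EuclideanSpace.complexify ∘ u) := by
    funext y
    simp only [Function.comp_apply, Pi.smul_apply, LinearIsometry.map_smul]
    exact RCLike.real_smul_eq_coe_smul c _
  rw [this, mFourierCoeff_const_smul]

end SymL2

end Torus

end Literature.Analysis.FunctionSpaces
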